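import Literature.Computability.AlgebraicComplexity.LaserProductRecursion
import Literature.Computability.AlgebraicComplexity.BigCwSquareOmega
import Literature.Computability.AlgebraicComplexity.InterfaceMatMulTerms
import HarnessLib

/-!
# The fourth power of the Coppersmith–Winograd tensor: its decomposition, the matrix components
(Le Gall 2014, Lemma 6.1) and the values of its components by the recursion of §5 — proved

Topic `Literature/Computability/AlgebraicComplexity`.  Le Gall, *Powers of tensors and fast matrix
multiplication* (ISSAC 2014, arXiv:1401.7714), §6.2 analyses `t^{⊗4} = t^{⊗2} ⊗ t^{⊗2}` for the
Coppersmith–Winograd tensor `t = CW_q` by the recursion of §5 (`LaserProductRecursion.lean`):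

> The support of its decomposition `D^4` is the set of all triples
> `(a,b,c) ∈ {0,…,8} × {0,…,8} × {0,…,8}` such that `a + b + c = 8`. … we also need a lower bound on
> the value of each component `t^{⊗4}(a,b,c)` before applying `A` on `t^{⊗4}`. Using the method
> described in Section 5, these lower bounds are computed recursively by applying Algorithm `A` on
> the decomposition `D_{abc}` of the component. Actually, we do not need to apply `A` when `a = 0`,
> `b = 0` or `c = 0`, since a lower bound on the value can be found analytically in this case.
>
> **Lemma 6.1.** For any `r ≥ 0` and any `b ∈ {0,1,…,2^r}`,
> `V_ρ(t^{⊗2^r}(2^{r+1} − b, b, 0)) ≥ (∑_{e ≡ b mod 2} (2^r)! / (e! ((b−e)/2)! (2^r − (b+e)/2)!) q^e)^{ρ/3}`.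

This file PROVES, in the tree's coordinates (`bigCwSq = CW_q ⊗ CW_q` with its level-2 labels
`cwLev2` and components `cwSqComp`, `BigCwSquareComponents.lean`):

* `cwVal2`, `hasLaserValue_symm3_cwSqComp` — the fifteen level-2 component values of
  `BigCwSquareComponents.lean` / `BigCwSquareValue112.lean` as ONE function of the label
  (`1`, `(2q)^ρ`, `(q²+2)^ρ`, `2^{2+H_Z(σ)} q^{ρ(1+σ)}`; Le Gall values cubed), for general `q ≥ 1`;
* `bigCwFour = CW_q^{⊗2} ⊗ CW_q^{⊗2}`, its level-4 labels `cwLev4 ∈ {0,…,8}` (sums) and pair labels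
  `cwPairLev4`, weight `8` on the support (`bigCwFour_weight`, `bigCwFour_cwSupport₄`), the
  components `cw4Comp a b c = t^{⊗4}(a,b,c)`, their cyclic symmetry (`cw4Comp_rotate`), tightness
  (`cwTight₄*`) and `R̃(t^{⊗4}) ≤ (q+2)^4` (`asymptoticRank_bigCwFour_le`);
* `hasLaserValue_symm3_cw4Comp` — **the recursion of §5 for `t^{⊗4}`**: for any `S ⊆ S_{abc}`
  carrying the pair decomposition of `t^{⊗4}(a,b,c)` and any probability distribution `P` on `S`,
  `V_ρ(t^{⊗4}(a,b,c))³ ≥ 2^{H(P₁)+H(P₂)+H(P₃) − 3Γ_S(P)} ∏_{s∈S} (V₂(s₁) V₂(s₂))^{P(s)}`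
  with the level-2 values `V₂ = cwVal2`;
* **Lemma 6.1 for `r = 2`**, proved through unit slices: `isUnitSlice_bigCwTensor` (the `x₀`-slice
  of `CW_q` is the graph of `a ↦ ā`), hence of `CW_q^{⊗2}` and `CW_q^{⊗4}`; the level counts
  `cwCount1/2/4` with `cwCount4 q b = |{y : level 4 label b}| = 1, 4q, 6q²+4, 4q³+12q, q⁴+12q²+6, …`
  (`cwCount4_values`, the polynomials of Lemma 6.1), and
  `hasLaserValue_symm3_cw4Comp_zero{,₂,₃}` — **`V_ρ(t^{⊗4}(0,b,c))³ ≥ (cwCount4 q b)^ρ`** and its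
  rotations;
* `omega_le_of_laserMethodSym_cubed` — Le Gall's Theorem 2.2 + 4.1 bound on `ω` with the
  component values given in cubed form (the shape produced by the recursion).

Everything is proved; no named facts.  The numerical evaluation at `q = 5` (Le Gall Table 3,
`ω < 2.373`) is in `BigCwFourthOmega*.lean`.

## References

* F. Le Gall, ISSAC 2014, arXiv:1401.7714 (held: `paper:arxiv-1401.7714`): §5, Lemma 6.1, §6.2,
  Tables 2–3 (pp. 9–14). [LeGall2014]
* D. Coppersmith, S. Winograd, J. Symbolic Comput. 9 (1990), §8. [CoppersmithWinograd1990]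
* A. J. Stothers, PhD thesis, Edinburgh 2010, §4 (the fourth power), Claim 7.
-/

noncomputable section

open scoped BigOperators
open Finset Real
open Literature.Barriers.MatrixMultiplication (bigCwTensor bigCwTensor_apply bigCwTensor_corner)

namespace Literature.Computability.AlgebraicComplexity

universe u

/-! ## The fifteen level-2 values as one function -/

section LevelTwo

variable (q : ℕ) (ρ σ : ℝ)

/-- The (cubed) value bound of the `[112]`-type components, `2^{2 + H_Z(σ)} (q^{(ρ/3)(1+σ)})³`
(`hasLaserValue_symm3_cwSqComp112`). [cite: CoppersmithWinograd1990, §8] -/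
def cwV112 : ℝ :=
  (2 : ℝ) ^ (2 + (2 * negMulLog ((1 - σ) / 2) + negMulLog σ) / Real.log 2) *
    ((((q : ℕ) : ℝ) ^ (ρ / 3 * (1 + σ))) ^ 3)

/-- **The level-2 component values (cubed)** as a function of the label: `1` on the `[004]`-type,
`(2q)^ρ` on the `[013]`-type, `(q²+2)^ρ` on the `[022]`-type, `cwV112` on the `[112]`-type (and a
positive junk value off the weight-4 layer). [cite: LeGall2014, §6.2 (r = 1)] -/
def cwVal2 (s : Fin 5 × Fin 5 × Fin 5) : ℝ :=
  if max (s.1 : ℕ) (max s.2.1 s.2.2) = 4 then 1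
  else if max (s.1 : ℕ) (max s.2.1 s.2.2) = 3 then (((2 * q : ℕ) : ℝ) ^ (ρ / 3)) ^ 3
  else if min (s.1 : ℕ) (min s.2.1 s.2.2) = 0 then (((q * q + 2 : ℕ) : ℝ) ^ (ρ / 3)) ^ 3
  else cwV112 q ρ σ

variable {q} in
/-- The level-2 values are positive (`q ≥ 1`). [folklore] -/
theorem cwVal2_pos (hq : 1 ≤ q) (s : Fin 5 × Fin 5 × Fin 5) : 0 < cwVal2 q ρ σ s := by
  have hq0 : (0 : ℝ) < (q : ℕ) := by exact_mod_cast hq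
  simp only [cwVal2, cwV112]
  split_ifs <;> positivity

variable {q} in
/-- **The values of the fifteen level-2 components of `CW_q^{⊗2}`** (general `q ≥ 1`, `σ ∈ (0,1)`).
[cite: LeGall2014, §6.2 (r = 1); CoppersmithWinograd1990, §8] -/
theorem hasLaserValue_symm3_cwSqComp (K : Type u) [Field K] (hq : 1 ≤ q) (hσ0 : 0 < σ) (hσ1 : σ < 1)
    (s : Fin 5 × Fin 5 × Fin 5) (hs : (s.1 : ℕ) + s.2.1 + s.2.2 = 4) :
    HasLaserValue ρ (symm3 (cwSqComp K q s.1 s.2.1 s.2.2)) (cwVal2 q ρ σ s) := by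
  have v1 : ∀ a b c : Fin 5, max (a : ℕ) (max b c) = 4 → cwVal2 q ρ σ (a, b, c) = 1 :=
    fun a b c h => by simp only [cwVal2, h, if_true]
  have v2 : ∀ a b c : Fin 5, max (a : ℕ) (max b c) = 3 →
      cwVal2 q ρ σ (a, b, c) = (((2 * q : ℕ) : ℝ) ^ (ρ / 3)) ^ 3 := fun a b c h => by
    simp only [cwVal2, h]; norm_num
  have v3 : ∀ a b c : Fin 5, max (a : ℕ) (max b c) = 2 → min (a : ℕ) (min b c) = 0 →
      cwVal2 q ρ σ (a, b, c) = (((q * q + 2 : ℕ) : ℝ) ^ (ρ / 3)) ^ 3 := fun a b c h h' => by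
    simp only [cwVal2, h, h']; norm_num
  have v4 : ∀ a b c : Fin 5, max (a : ℕ) (max b c) = 2 → min (a : ℕ) (min b c) = 1 →
      cwVal2 q ρ σ (a, b, c) = cwV112 q ρ σ := fun a b c h h' => by
    simp only [cwVal2, h, h']; norm_num
  have hs' : s ∈ cwSupport₂ := mem_cwSupport₂.2 hs
  rw [cwSupport₂_eq] at hs'
  simp only [Finset.mem_insert, Finset.mem_singleton] at hs'
  rcases hs' with rfl | rfl | rfl | rfl | rfl | rfl | rfl | rfl | rfl | rfl | rfl | rfl | rfl | rfl | rfl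
  · rw [v1 _ _ _ (by decide)]; exact hasLaserValue_symm3_cwSqComp004 K q _
  · rw [v1 _ _ _ (by decide)]; exact hasLaserValue_symm3_cwSqComp040 K q _
  · rw [v1 _ _ _ (by decide)]; exact hasLaserValue_symm3_cwSqComp400 K q _
  · rw [v2 _ _ _ (by decide)]; exact hasLaserValue_symm3_cwSqComp013 K q _
  · rw [v2 _ _ _ (by decide)]; exact hasLaserValue_symm3_cwSqComp031 K q _
  · rw [v2 _ _ _ (by decide)]; exact hasLaserValue_symm3_cwSqComp103 K q _
  · rw [v2 _ _ _ (by decide)]; exact hasLaserValue_symm3_cwSqComp130 K q _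
  · rw [v2 _ _ _ (by decide)]; exact hasLaserValue_symm3_cwSqComp301 K q _
  · rw [v2 _ _ _ (by decide)]; exact hasLaserValue_symm3_cwSqComp310 K q _
  · rw [v3 _ _ _ (by decide) (by decide)]; exact hasLaserValue_symm3_cwSqComp022 K q _
  · rw [v3 _ _ _ (by decide) (by decide)]; exact hasLaserValue_symm3_cwSqComp202 K q _
  · rw [v3 _ _ _ (by decide) (by decide)]; exact hasLaserValue_symm3_cwSqComp220 K q _
  · rw [v4 _ _ _ (by decide) (by decide)]; exact hasLaserValue_symm3_cwSqComp112 K q hq _ _ hσ0 hσ1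
  · rw [v4 _ _ _ (by decide) (by decide)]; exact hasLaserValue_symm3_cwSqComp121 K q hq _ _ hσ0 hσ1
  · rw [v4 _ _ _ (by decide) (by decide)]; exact hasLaserValue_symm3_cwSqComp211 K q hq _ _ hσ0 hσ1

end LevelTwo

/-! ## `CW_q^{⊗4} = CW_q^{⊗2} ⊗ CW_q^{⊗2}` and its level-4 decomposition -/

section Four

variable (K : Type u) [Field K] (q : ℕ)

/-- The indices of `CW_q^{⊗4}` (pairs of pairs). [folklore] -/
abbrev CwIdx4 := (Fin (q + 2) × Fin (q + 2)) × (Fin (q + 2) × Fin (q + 2))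

/-- **`t^{⊗4} = t^{⊗2} ⊗ t^{⊗2}`** for `t = CW_q`. [cite: LeGall2014, §5 (p. 10: "t^{⊗4} = t^{⊗2} ⊗ t^{⊗2}")] -/
abbrev bigCwFour : CwIdx4 q → CwIdx4 q → CwIdx4 q → K :=
  kroneckerTensor (bigCwSq K q) (bigCwSq K q)

variable {q} in
/-- Pair labels of `t^{⊗4}`: the two level-2 labels. [cite: LeGall2014, §5] -/
abbrev cwPairLev4 (x : CwIdx4 q) : Fin 5 × Fin 5 := pairLab cwLev2 cwLev2 x

variable {q} in
/-- **Level-4 labels** of `t^{⊗4}`: the sum of the two level-2 labels, in `{0,…,8}`.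
[cite: LeGall2014, §6.2] -/
abbrev cwLev4 (x : CwIdx4 q) : Fin 9 := sumLab cwLev2 cwLev2 x

/-- **The component `t^{⊗4}(a,b,c)`.** [cite: LeGall2014, §6.2] -/
abbrev cw4Comp (a b c : Fin 9) : CwIdx4 q → CwIdx4 q → CwIdx4 q → K :=
  prodComp cwLev2 cwLev2 cwLev2 cwLev2 cwLev2 cwLev2 (bigCwSq K q) (bigCwSq K q) a b c

/-- The level-2 labels of `t^{⊗2}` have weight `4` on its support. [cite: CoppersmithWinograd1990, §8] -/
theorem bigCwSq_weight (x y z : Fin (q + 2) × Fin (q + 2)) (h : bigCwSq K q x y z ≠ 0) :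
    (cwLev2 x : ℕ) + cwLev2 y + cwLev2 z = 4 :=
  mem_cwSupport₂.1 (bigCwSq_cwSupport₂ K q x y z h)

/-- **The level-4 labels have weight `8` on the support of `t^{⊗4}`.** [cite: LeGall2014, §6.2] -/
theorem bigCwFour_weight (x y z : CwIdx4 q) (h : bigCwFour K q x y z ≠ 0) :
    (cwLev4 x : ℕ) + cwLev4 y + cwLev4 z = 8 :=
  sumLab_weight cwLev2 cwLev2 cwLev2 cwLev2 cwLev2 cwLev2 (bigCwSq_weight K q) (bigCwSq_weight K q)
    x y z h

/-- **The level-4 support `{(a,b,c) | a + b + c = 8}`.** [cite: LeGall2014, §6.2] -/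
def cwSupport₄ : Finset (Fin 9 × Fin 9 × Fin 9) :=
  Finset.univ.filter fun s => (s.1 : ℕ) + s.2.1 + s.2.2 = 8

/-- Membership in the level-4 support. [folklore] -/
theorem mem_cwSupport₄ {s : Fin 9 × Fin 9 × Fin 9} :
    s ∈ cwSupport₄ ↔ (s.1 : ℕ) + s.2.1 + s.2.2 = 8 := by
  simp [cwSupport₄]

/-- The level-4 support has `45` elements (Le Gall: "ten components" up to `S₃`). [cite: LeGall2014, §6.2] -/
theorem card_cwSupport₄ : cwSupport₄.card = 45 := by
  decide

/-- The labels of the support of `t^{⊗4}` lie in `cwSupport₄`. [cite: LeGall2014, §6.2] -/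
theorem bigCwFour_cwSupport₄ (x y z : CwIdx4 q) (h : bigCwFour K q x y z ≠ 0) :
    (cwLev4 x, cwLev4 y, cwLev4 z) ∈ cwSupport₄ :=
  mem_cwSupport₄.2 (bigCwFour_weight K q x y z h)

/-- **The pair labels of the support of `t^{⊗4}(a,b,c)` lie in `S_{abc}`.** [cite: LeGall2014, §5 (p. 10)] -/
theorem cw4Comp_pairSupp (a b c : Fin 9) (x y z : CwIdx4 q) (h : cw4Comp K q a b c x y z ≠ 0) :
    (cwPairLev4 x, cwPairLev4 y, cwPairLev4 z) ∈ pairSupp 4 4 4 4 a b c :=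
  prodComp_pairSupp cwLev2 cwLev2 cwLev2 cwLev2 cwLev2 cwLev2 (bigCwSq_weight K q)
    (bigCwSq_weight K q) a b c x y z h

/-! ### Tightness and rank -/

/-- Tightness vectors of the level-4 labels (first two slots). [folklore] -/
def cwTight₄ (i : Fin 9) : Fin 1 → ℤ := fun _ => (i : ℕ)

/-- Tightness vectors of the level-4 labels (third slot): the label minus `8`. [folklore] -/
def cwTight₄γ (l : Fin 9) : Fin 1 → ℤ := fun _ => (l : ℕ) - 8

/-- `cwTight₄` is injective. [folklore] -/
theorem cwTight₄_injective : Function.Injective cwTight₄ := fun i j h => by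
  have h0 := congrFun h 0
  simp only [cwTight₄, Nat.cast_inj] at h0
  exact Fin.ext h0

/-- `cwTight₄γ` is injective. [folklore] -/
theorem cwTight₄γ_injective : Function.Injective cwTight₄γ := fun i j h => by
  have h0 := congrFun h 0
  simp only [cwTight₄γ, sub_left_inj, Nat.cast_inj] at h0
  exact Fin.ext h0

/-- `|cwTight₄ i| ≤ 8`. [folklore] -/
theorem cwTight₄_bound (i : Fin 9) (k : Fin 1) : |cwTight₄ i k| ≤ (8 : ℕ) := by
  have := i.isLt
  simp only [cwTight₄]
  rw [abs_le]; constructor <;> push_cast <;> omega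

/-- `|cwTight₄γ l| ≤ 8`. [folklore] -/
theorem cwTight₄γ_bound (l : Fin 9) (k : Fin 1) : |cwTight₄γ l k| ≤ (8 : ℕ) := by
  have := l.isLt
  simp only [cwTight₄γ]
  rw [abs_le]; constructor <;> push_cast <;> omega

/-- The level-4 decomposition is tight. [cite: LeGall2014, §5 (p. 10)] -/
theorem cwTight₄_sum (s : Fin 9 × Fin 9 × Fin 9) (hs : s ∈ cwSupport₄) (k : Fin 1) :
    cwTight₄ s.1 k + cwTight₄ s.2.1 k + cwTight₄γ s.2.2 k = 0 := by
  rw [mem_cwSupport₄] at hs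
  simp only [cwTight₄, cwTight₄γ]
  omega

/-- **`R̃(t^{⊗4}) ≤ (q+2)^4`** (`R̲(CW_q) ≤ q + 2` and submultiplicativity). [cite: LeGall2014, §6.2 ("R(t^{⊗4}) ≤ (q+2)^4")] -/
theorem asymptoticRank_bigCwFour_le : asymptoticRank (bigCwFour K q) ≤ ((q : ℝ) + 2) ^ 4 := by
  have h := asymptoticRank_bigCwTensor_le K q
  have h0 := asymptoticRank_nonneg (bigCwTensor K q)
  have h2 : asymptoticRank (bigCwSq K q) ≤ ((q : ℝ) + 2) ^ 2 :=
    calc asymptoticRank (bigCwSq K q)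
        ≤ asymptoticRank (bigCwTensor K q) * asymptoticRank (bigCwTensor K q) :=
          asymptoticRank_kronecker_le _ _
      _ ≤ ((q : ℝ) + 2) * ((q : ℝ) + 2) := mul_le_mul h h h0 (by positivity)
      _ = ((q : ℝ) + 2) ^ 2 := by ring
  have h20 := asymptoticRank_nonneg (bigCwSq K q)
  calc asymptoticRank (bigCwFour K q)
      ≤ asymptoticRank (bigCwSq K q) * asymptoticRank (bigCwSq K q) := asymptoticRank_kronecker_le _ _
    _ ≤ ((q : ℝ) + 2) ^ 2 * ((q : ℝ) + 2) ^ 2 := mul_le_mul h2 h2 h20 (by positivity)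
    _ = ((q : ℝ) + 2) ^ 4 := by ring

/-! ### Cyclic symmetry -/

/-- `t^{⊗4}` is invariant under cyclic rotation of its slots. [cite: LeGall2014, §6.2 (D^4 is S₃-invariant)] -/
theorem rotate_bigCwFour : rotate (bigCwFour K q) = bigCwFour K q := by
  rw [show bigCwFour K q = kroneckerTensor (bigCwSq K q) (bigCwSq K q) from rfl, rotate_kroneckerTensor,
    rotate_bigCwSq]

/-- **`t^{⊗4}(b,c,a) = (t^{⊗4}(a,b,c))_C`.** [cite: LeGall2014, §6.2] -/
theorem cw4Comp_rotate (a b c : Fin 9) : cw4Comp K q b c a = rotate (cw4Comp K q a b c) := by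
  rw [show cw4Comp K q b c a = partSubtensor cwLev4 cwLev4 cwLev4 (rotate (bigCwFour K q)) {b} {c} {a}
    by rw [rotate_bigCwFour]]
  exact partSubtensor_rotate _ _ _ _ _ _ _

/-! ### The recursion of §5 on `t^{⊗4}(a,b,c)` -/

variable {q}

/-- **Le Gall §5 for `t^{⊗4} = t^{⊗2} ⊗ t^{⊗2}`**: for `q ≥ 1`, `σ ∈ (0,1)`, any `S ⊆ S_{abc}`
carrying the pair decomposition of `t^{⊗4}(a,b,c)` and any probability distribution `P` on `S`,
`V_ρ(t^{⊗4}(a,b,c))³ ≥ 2^{H(P₁)+H(P₂)+H(P₃) − 3Γ_S(P)} ∏_{s ∈ S} (V₂(s₁) V₂(s₂))^{P(s)}` with the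
level-2 values `V₂ = cwVal2 q ρ σ`. [cite: LeGall2014, §5 and §6.2] -/
theorem hasLaserValue_symm3_cw4Comp (hq : 1 ≤ q) {ρ σ : ℝ} (hσ0 : 0 < σ) (hσ1 : σ < 1)
    (a b c : Fin 9)
    (S : Finset ((Fin 5 × Fin 5) × (Fin 5 × Fin 5) × (Fin 5 × Fin 5)))
    (hS : ∀ x y z, cw4Comp K q a b c x y z ≠ 0 → (cwPairLev4 x, cwPairLev4 y, cwPairLev4 z) ∈ S)
    (hSw : ∀ s ∈ S, s ∈ pairSupp 4 4 4 4 a b c)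
    (P : (Fin 5 × Fin 5) × (Fin 5 × Fin 5) × (Fin 5 × Fin 5) → ℝ) (hP0 : ∀ s, 0 ≤ P s)
    (hP1 : ∑ s, P s = 1) (hPS : ∀ s, s ∉ S → P s = 0) :
    HasLaserValue ρ (symm3 (cw4Comp K q a b c))
      ((2 : ℝ) ^ (shannonEntropy (marginalDist₁ P) + shannonEntropy (marginalDist₂ P) +
          shannonEntropy (marginalDist₃ P) - 3 * maxEntropyPenalty S P) *
        ∏ s ∈ S, (cwVal2 q ρ σ (s.1.1, s.2.1.1, s.2.2.1) * cwVal2 q ρ σ (s.1.2, s.2.1.2, s.2.2.2)) ^ P s) :=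
  hasLaserValue_symm3_prodComp cwLev2 cwLev2 cwLev2 cwLev2 cwLev2 cwLev2 (bigCwSq K q) (bigCwSq K q)
    (cwVal2 q ρ σ) (cwVal2 q ρ σ) (cwVal2_pos ρ σ hq) (cwVal2_pos ρ σ hq)
    (fun s hs => hasLaserValue_symm3_cwSqComp ρ σ K hq hσ0 hσ1 s hs)
    (fun s hs => hasLaserValue_symm3_cwSqComp ρ σ K hq hσ0 hσ1 s hs) a b c S hS hSw P hP0 hP1 hPS

end Four

/-! ## Lemma 6.1: the components with a zero label -/

section UnitSlices

variable (K : Type u) [Field K] (q : ℕ)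

/-- **The `x₀`-slice of `CW_q` is the graph of `a ↦ ā`**: `CW_q(x₀, y, z) = [z = ȳ]`
(`x₀ y₀ z_{q+1} + ∑ x₀ y_i z_i + x₀ y_{q+1} z₀`). [cite: CoppersmithWinograd1990, §7 eq. (10)] -/
theorem isUnitSlice_bigCwTensor : IsUnitSlice (bigCwTensor K q) 0 Finset.univ cwDual := by
  refine ⟨cwDual_injective.injOn, fun y z => ?_⟩
  simp only [Finset.mem_univ, true_and]
  have hl0 : Fin.last (q + 1) ≠ (0 : Fin (q + 2)) := by simp [Fin.ext_iff]
  induction y using cwCases with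
  | zero =>
    rw [cwDual_zero]
    induction z using cwCases with
    | zero => rw [if_neg hl0.symm]; simp [bigCwTensor_apply, hl0.symm]
    | mid j => rw [if_neg (cwMid_ne_last j), bigCwTensor_zero_zero_mid]
    | last => rw [if_pos rfl, bigCwTensor_corner]
  | mid i =>
    rw [cwDual_of_ne (cwMid_ne_zero i) (cwMid_ne_last i)]
    induction z using cwCases with
    | zero => rw [if_neg (zero_ne_cwMid i), bigCwTensor_zero_mid_zero]
    | mid j =>
      rw [bigCwTensor_zero_mid_mid]
      by_cases h : i = j
      · subst h; simp
      · rw [if_neg h, if_neg (fun e => h (cwMid_inj.1 e).symm)]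
    | last => rw [if_neg (last_ne_cwMid i), bigCwTensor_zero_mid_last]
  | last =>
    rw [cwDual_last]
    induction z using cwCases with
    | zero => rw [if_pos rfl, bigCwTensor_zero_last_zero]
    | mid j => rw [if_neg (cwMid_ne_zero j), bigCwTensor_zero_last_mid]
    | last => rw [if_neg hl0, bigCwTensor_zero_last_last]

/-- The `x₀₀`-slice of `CW_q^{⊗2}` is the graph of `(a,b) ↦ (ā,b̄)`. [cite: LeGall2014, Lemma 6.1] -/
theorem isUnitSlice_bigCwSq :
    IsUnitSlice (bigCwSq K q) (0, 0) Finset.univ (Prod.map cwDual cwDual) := by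
  have h := (isUnitSlice_bigCwTensor K q).kronecker (isUnitSlice_bigCwTensor K q)
  rwa [Finset.univ_product_univ] at h

/-- The partner map of the indices of `t^{⊗4}`. [cite: LeGall2014, Lemma 6.1] -/
abbrev cwDual4 (y : CwIdx4 q) : CwIdx4 q := Prod.map (Prod.map cwDual cwDual) (Prod.map cwDual cwDual) y

/-- The `x₀₀₀₀`-slice of `CW_q^{⊗4}` is the graph of the partner map. [cite: LeGall2014, Lemma 6.1] -/
theorem isUnitSlice_bigCwFour :
    IsUnitSlice (bigCwFour K q) ((0, 0), (0, 0)) Finset.univ (cwDual4 q) := by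
  have h := (isUnitSlice_bigCwSq K q).kronecker (isUnitSlice_bigCwSq K q)
  rwa [Finset.univ_product_univ] at h

variable {q} in
/-- Levels of partners at level 4: `level(ȳ) = 8 − level(y)`. [cite: LeGall2014, Lemma 6.1] -/
theorem coe_cwLev4_cwDual4 (y : CwIdx4 q) : (cwLev4 (cwDual4 q y) : ℕ) = 8 - cwLev4 y := by
  have h1 := cwLevel_le_two y.1.1
  have h2 := cwLevel_le_two y.1.2
  have h3 := cwLevel_le_two y.2.1
  have h4 := cwLevel_le_two y.2.2
  simp only [coe_addLab, coe_cwLevSum, cwLevel₃_val, Prod.map_fst, Prod.map_snd, cwLevel_cwDual]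
  omega

variable {q} in
/-- `x₀₀₀₀` has level `0`. [folklore] -/
theorem cwLev4_zero : cwLev4 (((0 : Fin (q + 2)), (0 : Fin (q + 2))), ((0 : Fin (q + 2)), (0 : Fin (q + 2)))) = 0 := by
  ext
  simp

/-- **The `x₀₀₀₀`-slice of `t^{⊗4}(0,b,c)` is a unit slice** over the `y` of level `b` whose partner
has level `c`. [cite: LeGall2014, Lemma 6.1] -/
theorem isUnitSlice_cw4Comp_zero (b c : Fin 9) :
    IsUnitSlice (cw4Comp K q 0 b c) ((0, 0), (0, 0))
      (Finset.univ.filter fun y : CwIdx4 q =>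
        cwLev4 y ∈ ({b} : Finset (Fin 9)) ∧ cwLev4 (cwDual4 q y) ∈ ({c} : Finset (Fin 9)))
      (cwDual4 q) :=
  (isUnitSlice_bigCwFour K q).partSubtensor (Finset.mem_singleton.2 cwLev4_zero) {b} {c}

/-! ### Level counts (the polynomials of Lemma 6.1) -/

/-- The number of indices of `CW_q` of level `ℓ`. [folklore] -/
def cwCount1 (ℓ : ℕ) : ℕ := (Finset.univ.filter fun y : Fin (q + 2) => cwLevel y = ℓ).card

/-- The number of indices of `CW_q^{⊗2}` of level `n`. [cite: LeGall2014, Lemma 6.1] -/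
def cwCount2 (n : ℕ) : ℕ :=
  (Finset.univ.filter fun y : Fin (q + 2) × Fin (q + 2) => cwLevel y.1 + cwLevel y.2 = n).card

/-- The number of indices of `CW_q^{⊗4}` of level `n`. [cite: LeGall2014, Lemma 6.1] -/
def cwCount4 (n : ℕ) : ℕ :=
  (Finset.univ.filter fun y : CwIdx4 q =>
    (cwLevel y.1.1 + cwLevel y.1.2) + (cwLevel y.2.1 + cwLevel y.2.2) = n).card

/-- One index of level `0`. [folklore] -/
theorem cwCount1_zero : cwCount1 q 0 = 1 := by
  rw [cwCount1, show (Finset.univ.filter fun y : Fin (q + 2) => cwLevel y = 0) = {0} by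
    ext y; simp [cwLevel_eq_zero_iff]]
  rfl

/-- `q` indices of level `1`. [folklore] -/
theorem cwCount1_one : cwCount1 q 1 = q := by
  rw [cwCount1, show (Finset.univ.filter fun y : Fin (q + 2) => cwLevel y = 1) =
      Finset.univ.image cwMid by
    ext y
    simp only [Finset.mem_filter, Finset.mem_univ, true_and, Finset.mem_image]
    rw [cwLevel_eq_one_iff]
    constructor <;> rintro ⟨i, hi⟩ <;> exact ⟨i, hi.symm⟩]
  rw [Finset.card_image_of_injective _ (fun i j h => cwMid_inj.1 h), Finset.card_univ, Fintype.card_fin]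

/-- One index of level `2`. [folklore] -/
theorem cwCount1_two : cwCount1 q 2 = 1 := by
  rw [cwCount1, show (Finset.univ.filter fun y : Fin (q + 2) => cwLevel y = 2) = {Fin.last (q + 1)} by
    ext y; simp [cwLevel_eq_two_iff]]
  rfl

/-- No index of level `≥ 3`. [folklore] -/
theorem cwCount1_of_three_le {ℓ : ℕ} (h : 3 ≤ ℓ) : cwCount1 q ℓ = 0 := by
  rw [cwCount1, Finset.card_eq_zero, Finset.filter_eq_empty_iff]
  intro y _ hy
  have := cwLevel_le_two y
  omega

/-- The level-2 counts are convolutions of the level-1 counts. [cite: LeGall2014, Lemma 6.1] -/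
theorem cwCount2_eq_sum (n : ℕ) :
    cwCount2 q n = ∑ i ∈ Finset.range (n + 1), cwCount1 q i * cwCount1 q (n - i) :=
  card_filter_add_eq_sum (fun y : Fin (q + 2) => cwLevel y) (fun y : Fin (q + 2) => cwLevel y) n

/-- The level-4 counts are convolutions of the level-2 counts. [cite: LeGall2014, Lemma 6.1] -/
theorem cwCount4_eq_sum (n : ℕ) :
    cwCount4 q n = ∑ i ∈ Finset.range (n + 1), cwCount2 q i * cwCount2 q (n - i) :=
  card_filter_add_eq_sum (fun y : Fin (q + 2) × Fin (q + 2) => cwLevel y.1 + cwLevel y.2)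
    (fun y : Fin (q + 2) × Fin (q + 2) => cwLevel y.1 + cwLevel y.2) n

/-- The level-1 counts beyond `2` needed in the convolutions vanish. [folklore] -/
private theorem cwCount1_vals : cwCount1 q 0 = 1 ∧ cwCount1 q 1 = q ∧ cwCount1 q 2 = 1 ∧ cwCount1 q 3 = 0 ∧
    cwCount1 q 4 = 0 ∧ cwCount1 q 5 = 0 ∧ cwCount1 q 6 = 0 ∧ cwCount1 q 7 = 0 ∧ cwCount1 q 8 = 0 :=
  ⟨cwCount1_zero q, cwCount1_one q, cwCount1_two q, cwCount1_of_three_le q (by norm_num),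
    cwCount1_of_three_le q (by norm_num), cwCount1_of_three_le q (by norm_num),
    cwCount1_of_three_le q (by norm_num), cwCount1_of_three_le q (by norm_num),
    cwCount1_of_three_le q (by norm_num)⟩

/-- **The level-2 counts: `1, 2q, q²+2, 2q, 1`** and `0` beyond. [cite: LeGall2014, §6.2 (r = 1: "(2q)", "(q²+2)")] -/
theorem cwCount2_values : cwCount2 q 0 = 1 ∧ cwCount2 q 1 = 2 * q ∧ cwCount2 q 2 = q * q + 2 ∧
    cwCount2 q 3 = 2 * q ∧ cwCount2 q 4 = 1 ∧ cwCount2 q 5 = 0 ∧ cwCount2 q 6 = 0 ∧ cwCount2 q 7 = 0 ∧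
      cwCount2 q 8 = 0 := by
  obtain ⟨e0, e1, e2, e3, e4, e5, e6, e7, e8⟩ := cwCount1_vals q
  refine ⟨?_, ?_, ?_, ?_, ?_, ?_, ?_, ?_, ?_⟩ <;>
  · rw [cwCount2_eq_sum]
    simp [Finset.sum_range_succ, e0, e1, e2, e3, e4, e5, e6, e7, e8]
    try ring

/-- **The level-4 counts (Lemma 6.1 for `r = 2`): `1, 4q, 6q²+4, 4q³+12q, q⁴+12q²+6, 4q³+12q,
6q²+4, 4q, 1`.** [cite: LeGall2014, Lemma 6.1 and Table 3] -/
theorem cwCount4_values : cwCount4 q 0 = 1 ∧ cwCount4 q 1 = 4 * q ∧ cwCount4 q 2 = 6 * q ^ 2 + 4 ∧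
    cwCount4 q 3 = 4 * q ^ 3 + 12 * q ∧ cwCount4 q 4 = q ^ 4 + 12 * q ^ 2 + 6 ∧
      cwCount4 q 5 = 4 * q ^ 3 + 12 * q ∧ cwCount4 q 6 = 6 * q ^ 2 + 4 ∧ cwCount4 q 7 = 4 * q ∧
        cwCount4 q 8 = 1 := by
  obtain ⟨e0, e1, e2, e3, e4, e5, e6, e7, e8⟩ := cwCount2_values q
  refine ⟨?_, ?_, ?_, ?_, ?_, ?_, ?_, ?_, ?_⟩ <;>
  · rw [cwCount4_eq_sum]
    simp [Finset.sum_range_succ, e0, e1, e2, e3, e4, e5, e6, e7, e8]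
    try ring

variable {q} in
/-- The unit slice of `t^{⊗4}(0,b,c)` with `b + c = 8` is indexed by the `y` of level `b`.
[cite: LeGall2014, Lemma 6.1] -/
theorem card_filter_cwLev4 (b c : Fin 9) (hbc : (b : ℕ) + c = 8) :
    (Finset.univ.filter fun y : CwIdx4 q =>
        cwLev4 y ∈ ({b} : Finset (Fin 9)) ∧ cwLev4 (cwDual4 q y) ∈ ({c} : Finset (Fin 9))).card =
      cwCount4 q b := by
  rw [cwCount4]
  congr 1
  refine Finset.filter_congr fun y _ => ?_
  have hd := coe_cwLev4_cwDual4 y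
  have hb : cwLev4 y = b ↔ (cwLev4 y : ℕ) = b := Fin.ext_iff
  have hc : cwLev4 (cwDual4 q y) = c ↔ (cwLev4 (cwDual4 q y) : ℕ) = c := Fin.ext_iff
  simp only [Finset.mem_singleton, hb, hc, hd]
  simp only [coe_addLab, coe_cwLevSum, cwLevel₃_val]
  have := (cwLev4 y).isLt
  simp only [coe_addLab, coe_cwLevSum, cwLevel₃_val] at this
  omega

/-! ### The values of the components with a zero label -/

/-- **Le Gall 2014, Lemma 6.1 (`r = 2`): `V_ρ(t^{⊗4}(0,b,c))³ ≥ (cwCount4 q b)^ρ`** for `b + c = 8`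
(`t^{⊗4}(0,b,c) ≅ ⟨1, cwCount4 q b, 1⟩`). [cite: LeGall2014, Lemma 6.1] -/
theorem hasLaserValue_symm3_cw4Comp_zero (ρ : ℝ) (b c : Fin 9) (hbc : (b : ℕ) + c = 8) :
    HasLaserValue ρ (symm3 (cw4Comp K q 0 b c)) ((((cwCount4 q b : ℕ) : ℝ) ^ (ρ / 3)) ^ 3) := by
  have h := (isUnitSlice_cw4Comp_zero K q b c).hasLaserValue_symm3 ρ
  rwa [card_filter_cwLev4 b c hbc] at h

/-- Lemma 6.1 rotated: `V_ρ(t^{⊗4}(a,b,0))³ ≥ (cwCount4 q a)^ρ` for `a + b = 8`. [cite: LeGall2014, Lemma 6.1] -/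
theorem hasLaserValue_symm3_cw4Comp_zero₃ (ρ : ℝ) (a b : Fin 9) (hab : (a : ℕ) + b = 8) :
    HasLaserValue ρ (symm3 (cw4Comp K q a b 0)) ((((cwCount4 q a : ℕ) : ℝ) ^ (ρ / 3)) ^ 3) := by
  rw [cw4Comp_rotate K q 0 a b]
  exact (hasLaserValue_symm3_cw4Comp_zero K q ρ a b hab).symm3_rotate

/-- Lemma 6.1 rotated twice: `V_ρ(t^{⊗4}(a,0,c))³ ≥ (cwCount4 q c)^ρ` for `a + c = 8`. [cite: LeGall2014, Lemma 6.1] -/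
theorem hasLaserValue_symm3_cw4Comp_zero₂ (ρ : ℝ) (a c : Fin 9) (hac : (a : ℕ) + c = 8) :
    HasLaserValue ρ (symm3 (cw4Comp K q a 0 c)) ((((cwCount4 q c : ℕ) : ℝ) ^ (ρ / 3)) ^ 3) := by
  rw [cw4Comp_rotate K q c a 0]
  exact (hasLaserValue_symm3_cw4Comp_zero₃ K q ρ c a (by omega)).symm3_rotate

end UnitSlices

/-! ## The bound on `ω` with cubed component values -/

section Omega

variable {K : Type u} [Field K]
variable {ι κ μ I J L : Type*} [Fintype ι] [Fintype κ] [Fintype μ] [DecidableEq ι] [DecidableEq κ]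
  [DecidableEq μ] [Fintype I] [Fintype J] [Fintype L] [DecidableEq I] [DecidableEq J] [DecidableEq L]

/-- **Le Gall Thm. 2.2 with Thm. 4.1, values in cubed form**: in the setting of
`omega_le_of_laserMethodSym`, if `V_ρ(t(s) ⊗ t(s)_C ⊗ t(s)_{C²}) ≥ V(s) > 0` for `s ∈ S` and
`R̃(t)³ < 2^{∑_ℓ H(P_ℓ) − 3Γ_S(P)} ∏_{s∈S} V(s)^{P(s)}`, then `ω ≤ ρ`.
[cite: LeGall2014, Thm. 2.2 and Thm. 4.1] -/
theorem omega_le_of_laserMethodSym_cubed (t : ι → κ → μ → K) (bI : ι → I) (bJ : κ → J)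
    (bL : μ → L) (S : Finset (I × J × L)) (hS : ∀ a b c, t a b c ≠ 0 → (bI a, bJ b, bL c) ∈ S)
    {r b : ℕ} (α : I → Fin r → ℤ) (β : J → Fin r → ℤ) (γ : L → Fin r → ℤ)
    (hα : Function.Injective α) (hβ : Function.Injective β) (hγ : Function.Injective γ)
    (hαb : ∀ i k, |α i k| ≤ b) (hβb : ∀ j k, |β j k| ≤ b) (hγb : ∀ l k, |γ l k| ≤ b)
    (htight : ∀ s ∈ S, ∀ k, α s.1 k + β s.2.1 k + γ s.2.2 k = 0)
    {ρ : ℝ} (hρ : 0 < ρ) (V : I × J × L → ℝ) (hV : ∀ s ∈ S, 0 < V s)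
    (hval : ∀ s ∈ S, HasLaserValue ρ
      (symm3 (partSubtensor bI bJ bL t {s.1} {s.2.1} {s.2.2})) (V s))
    (P : I × J × L → ℝ) (hP0 : ∀ s, 0 ≤ P s) (hP1 : ∑ s, P s = 1)
    (hPS : ∀ s, s ∉ S → P s = 0)
    (hbig : asymptoticRank t ^ 3 < (2 : ℝ) ^ (shannonEntropy (marginalDist₁ P) +
        shannonEntropy (marginalDist₂ P) + shannonEntropy (marginalDist₃ P) -
        3 * maxEntropyPenalty S P) * ∏ s ∈ S, V s ^ P s) :
    omega K ≤ ρ := by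
  classical
  set u : I × J × L → ℝ := fun s => V s ^ ((1 : ℝ) / 3) with hu_def
  have hu : ∀ s ∈ S, 0 < u s := fun s hs => Real.rpow_pos_of_pos (hV s hs) _
  have hu3 : ∀ s ∈ S, u s ^ 3 = V s := fun s hs => by
    rw [hu_def, ← Real.rpow_natCast, ← Real.rpow_mul (hV s hs).le]
    norm_num
  have hprod : (∏ s ∈ S, u s ^ P s) ^ 3 = ∏ s ∈ S, V s ^ P s := by
    rw [← Finset.prod_pow]
    refine Finset.prod_congr rfl fun s hs => ?_
    rw [hu_def, ← Real.rpow_natCast, ← Real.rpow_mul (hV s hs).le, ← Real.rpow_mul (hV s hs).le]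
    congr 1
    push_cast
    ring
  refine omega_le_of_laserMethodSym t bI bJ bL S hS α β γ hα hβ hγ hαb hβb hγb htight hρ u hu
    (fun s hs => by rw [hu3 s hs]; exact hval s hs) P hP0 hP1 hPS ?_
  rwa [hprod]

end Omega

end Literature.Computability.AlgebraicComplexity
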